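import Summits.HubbardSuperconductivity.HubbardSuperconductivity.Theorems.DeformationLadderLowEnergyRigidityTwistWeight
import Summits.HubbardSuperconductivity.HubbardSuperconductivity.Theorems.DeformationLadderLowEnergyRigidityTwistCost
import Summits.HubbardSuperconductivity.HubbardSuperconductivity.Theses.TwistGap

/-!
# Route `DeformationLadder`, crux `LowEnergyRigidity` (`stmt-HubbardSuperconductivity-1892`):
# the TWIST CEILING `R_L(s) ≤ C·s^{2/3}`; `TgTwistCeiling` (route `TwistGap`,
# `stmt-HubbardSuperconductivity-1514`) proved; tightness lemmas for the cruxes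

`R_L(s) := minEnergyOn (H_L + (s/L⁴)Δ_dᴴΔ_d; szSector N_L 0) − minEnergyOn (H_L; szSector N_L 0)`,
`H_L = hubbardTorus 2 L 1 U`, `N_L = 2⌊(1−δ)L²/2⌋`, is the penalty gap through which this route's
cruxes are read (`ladderThesis_iff_penaltyGap`; a `LadderThesis` witness `(U,δ,s,a)` is exactly
`R_L(s) ≥ a·s` at all large even `L`, `penaltyGap_ge_of_groundState`). Main results:

* `penaltyGap_le_of_twists` — the `J`-free window average: `R_L(s) ≤ 8π²J² + 16 s/J` for every
  `J ≥ 1` with `2J < L` (all `U, δ`, `s ≥ 0`) — the form to import with `J` free;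
* `penaltyGap_le_twistCeiling` — `∀ U δ, ∀ s ≥ 0, ∀ L ≥ 2⌈s^{1/3}⌉₊ + 1: R_L(s) ≤ (32π² + 32)·s^{2/3}`,
  in every model, superconducting or not;
* `tgTwistCeiling_proof : TgTwistCeiling` — the `TwistGap` support item, closed by name;
* `lro_mul_le_twistCeiling`, `lro_cube_mul_le_twistCeiling` — a normalised sector ground state of
  `H_L + (s/L⁴)Δ_dᴴΔ_d` with LRO density `≥ a` forces `a·s ≤ C s^{2/3}`, i.e. `a³ s ≤ C³`
  (`LadderThesis` witnesses decay like `s^{-1/3}`);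
* `rigidity_scale_le_twistCeiling` — a finite-`L` `LowEnergyRigidity` hypothesis `(κ, a)` forces
  `a·(κ/64) ≤ C (κ/64)^{2/3}` (`a³ κ ≤ 64 C³`): the quantitative form of "`κ < c·ρ_s` is forced".

Proof of the ceiling (Lieb–Schultz–Mattis twist × Parseval): empty sector — both energies are the
junk value `0`; `s ≤ 1` — `R_L(s) ≤ 32 s` (`minEnergyOn_penalised_le`); `s ≥ 1` — average the
Rayleigh quotients of the `2J` unit sector vectors `U_{±θ_j}ψ₀`, `J = ⌈s^{1/3}⌉`, `ψ₀` a sector ground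
state: the kinetic cost of the pair `±j` is `≤ 16π² j²` (`re_expect_lsmPerturbation_twist_le`,
`re_expect_twist_add_re_expect_twist_neg` of `…TwistCost`), the `2J` penalties share ONE Parseval
budget `(s/L⁴)·32L⁴` (`sum_twistWeights_le` of `…TwistWeight`), so
`R_L(s) ≤ 8π²J² + 16 s/J ≤ (32π² + 16)·s^{2/3}`.

Sources: Lieb–Schultz–Mattis, Ann. Phys. 16 (1961) 407, App. B; Oshikawa, PRL 84 (2000) 1535;
Tasaki, J. Stat. Phys. 170 (2018) 653, §2.2; Kennedy–Lieb–Shastry, PRL 61 (1988) 2582.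
-/

set_option linter.dupNamespace false

noncomputable section

namespace Summit.HubbardSuperconductivity.HubbardSuperconductivity.Theorems.DeformationLadder

open Matrix Complex Literature.MathematicalPhysics.QuantumLattice Literature.Probability.LatticeModels
  HubbardWave0
open Summit.HubbardSuperconductivity.HubbardSuperconductivity.Theses.DeformationLadder
open scoped Matrix.Norms.L2Operator ComplexOrder ComplexConjugate

/-! ### The twist ceiling -/

section Ceiling

/-- **Window-average twist bound (the `J`-free form of the twist ceiling).** For all `U, δ`,
`s ≥ 0`, and every `J ≥ 1` with `2J < L`:
`R_L(s) := minEnergyOn(H_L + (s/L⁴)Δ_dᴴΔ_d; szSector N_L 0) − minEnergyOn(H_L; ·) ≤ 8π²J² + 16 s/J`,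
`N_L = 2⌊(1−δ)L²/2⌋`. Proof: empty sector — both sides' energies are the junk value `0`; otherwise
average the Rayleigh quotients of the `2J` unit sector vectors `U_{±θ_j}ψ₀`, `j = 1..J` (`ψ₀` a
sector ground state, `θ_j` the `j`-fold spin-`↑` charge twist): the kinetic cost of the pair `±j` is
`2Re⟨ψ₀, P_{θ_j}ψ₀⟩ ≤ 16π² j²` (`re_expect_twist_add_re_expect_twist_neg`,
`re_expect_lsmPerturbation_twist_le`), and the `2J` penalties total `≤ (s/L⁴)·32L⁴`
(`sum_twistWeights_le`, Parseval); divide by `2J`. This is the lemma other routes import with `J`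
free (e.g. `CooperSharpness.TwistAveragingBound`). Lieb–Schultz–Mattis (1961) App. B;
Kennedy–Lieb–Shastry, PRL 61 (1988) 2582. [folklore] -/
theorem penaltyGap_le_of_twists (U δ : ℝ) {s : ℝ} (hs : 0 ≤ s) (L : ℕ) [NeZero L] {J : ℕ}
    (hJpos : 0 < J) (h2J : 2 * J < L) :
    (hubbardTorus 2 L 1 U + ((s / (L : ℝ) ^ 4 : ℝ) : ℂ) •
        ((pairField dWaveFormFactor L)ᴴ * pairField dWaveFormFactor L)).minEnergyOn
        (szSector (2 * ⌊(1 - δ) * (L : ℝ) ^ 2 / 2⌋₊) 0) -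
      (hubbardTorus 2 L 1 U).minEnergyOn (szSector (2 * ⌊(1 - δ) * (L : ℝ) ^ 2 / 2⌋₊) 0) ≤
      8 * Real.pi ^ 2 * (J : ℝ) ^ 2 + 16 * s / J := by
  classical
  set n : ℕ := ⌊(1 - δ) * (L : ℝ) ^ 2 / 2⌋₊ with hn
  set H := hubbardTorus 2 L 1 U with hH
  set P := (pairField dWaveFormFactor L)ᴴ * pairField dWaveFormFactor L with hP
  set K := szSector (Λ := FermionTorus 2 L) (2 * n) 0 with hK
  have hJreal : (0 : ℝ) < J := by exact_mod_cast hJpos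
  have hRHS : 0 ≤ 8 * Real.pi ^ 2 * (J : ℝ) ^ 2 + 16 * s / J := by positivity
  have hL4 : (0 : ℝ) < (L : ℝ) ^ 4 := by
    have : (0 : ℝ) < L := by exact_mod_cast Nat.pos_of_ne_zero (NeZero.ne L)
    positivity
  by_cases hKex : ∃ ψ ∈ K, star ψ ⬝ᵥ ψ = 1
  swap
  · -- empty sector: both sector energies are the junk value `sInf ∅ = 0`
    have hempty : ∀ A : Matrix (Finset (Orb (FermionTorus 2 L))) (Finset (Orb (FermionTorus 2 L))) ℂ,
        A.minEnergyOn K = 0 := by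
      intro A
      rw [Matrix.minEnergyOn]
      convert Real.sInf_empty
      rw [Set.eq_empty_iff_forall_notMem]
      rintro E ⟨ψ, hψK, hψ1, -⟩
      exact hKex ⟨ψ, hψK, hψ1⟩
    rw [hempty, hempty, sub_zero]
    exact hRHS
  -- a unit sector ground state and its twists
  obtain ⟨ψ₀, hψ₀K, hψ₀1, hE₀⟩ := exists_unit_groundState_hubbardTorus U hKex
  set θ : ZMod L → Orb (FermionTorus 2 L) → ℝ := fun q k => if (ofLex k).2 = 0 then
    2 * Real.pi * ((((q * FermionTorus.toTorusSite (ofLex k).1 0).val : ℕ) : ℝ)) / L else 0 with hθdef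
  have hθ : ∀ (q : ZMod L) (k : Orb (FermionTorus 2 L)), θ q k = if (ofLex k).2 = 0 then
      2 * Real.pi * ((((q * FermionTorus.toTorusSite (ofLex k).1 0).val : ℕ) : ℝ)) / L else 0 :=
    fun _ _ => rfl
  -- Rayleigh bound for each test state
  have hray : ∀ ϑ : Orb (FermionTorus 2 L) → ℝ,
      (H + ((s / (L : ℝ) ^ 4 : ℝ) : ℂ) • P).minEnergyOn K ≤
        (star (fockTwist ϑ *ᵥ ψ₀) ⬝ᵥ H *ᵥ (fockTwist ϑ *ᵥ ψ₀)).re +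
          s / (L : ℝ) ^ 4 * (star (fockTwist ϑ *ᵥ ψ₀) ⬝ᵥ P *ᵥ (fockTwist ϑ *ᵥ ψ₀)).re := by
    intro ϑ
    have hmem := fockTwist_mulVec_mem_szSector ϑ hψ₀K
    have hunit : star (fockTwist ϑ *ᵥ ψ₀) ⬝ᵥ (fockTwist ϑ *ᵥ ψ₀) = 1 := by
      rw [star_fockTwist_mulVec_dotProduct_self, hψ₀1]
    have h1 := minEnergyOn_le_re_rayleigh (H + ((s / (L : ℝ) ^ 4 : ℝ) : ℂ) • P) K hmem hunit
    rwa [add_mulVec, dotProduct_add, Complex.add_re, smul_mulVec, dotProduct_smul, smul_eq_mul,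
      Complex.re_ofReal_mul] at h1
  -- sum of the `2J` Rayleigh bounds
  have hsum : ∑ j ∈ Finset.Icc 1 J, ((H + ((s / (L : ℝ) ^ 4 : ℝ) : ℂ) • P).minEnergyOn K +
      (H + ((s / (L : ℝ) ^ 4 : ℝ) : ℂ) • P).minEnergyOn K) ≤
      ∑ j ∈ Finset.Icc 1 J, (2 * (star ψ₀ ⬝ᵥ H *ᵥ ψ₀).re + 2 * (8 * Real.pi ^ 2 * (j : ℝ) ^ 2)) +
        s / (L : ℝ) ^ 4 * ∑ j ∈ Finset.Icc 1 J,
          ((star (fockTwist (θ j) *ᵥ ψ₀) ⬝ᵥ P *ᵥ (fockTwist (θ j) *ᵥ ψ₀)).re +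
            (star (fockTwist (-θ j) *ᵥ ψ₀) ⬝ᵥ P *ᵥ (fockTwist (-θ j) *ᵥ ψ₀)).re) := by
    rw [Finset.mul_sum, ← Finset.sum_add_distrib]
    refine Finset.sum_le_sum fun j hj => ?_
    have hjL : j < L := by have := (Finset.mem_Icc.1 hj).2; omega
    have hval : ((j : ZMod L)).val = j := ZMod.val_cast_of_lt hjL
    have hcost := re_expect_twist_add_re_expect_twist_neg (L := L) 1 U (θ j) ψ₀
    have hpert : (star ψ₀ ⬝ᵥ lsmPerturbation (fermionTorusGraph 2 L) (θ j) 1 *ᵥ ψ₀).re ≤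
        8 * Real.pi ^ 2 * (j : ℝ) ^ 2 := by
      have h := re_expect_lsmPerturbation_twist_le θ hθ (j : ZMod L) 1 ψ₀
      rwa [hval, hψ₀1, Complex.one_re, mul_one, abs_one, mul_one] at h
    have hp := hray (θ j)
    have hm := hray (-θ j)
    nlinarith [hp, hm, hcost, hpert, div_nonneg hs hL4.le]
  -- evaluate / bound the three sums
  have hcard : (Finset.Icc 1 J).card = J := by simp
  rw [Finset.sum_const, hcard, Finset.sum_add_distrib, Finset.sum_const, hcard] at hsum
  have hweights := sum_twistWeights_le (L := L) θ hθ hψ₀1 h2J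
  have hsq : ∑ j ∈ Finset.Icc 1 J, 2 * (8 * Real.pi ^ 2 * (j : ℝ) ^ 2) ≤
      J * (16 * Real.pi ^ 2 * (J : ℝ) ^ 2) := by
    calc ∑ j ∈ Finset.Icc 1 J, 2 * (8 * Real.pi ^ 2 * (j : ℝ) ^ 2)
        ≤ ∑ _j ∈ Finset.Icc 1 J, 16 * Real.pi ^ 2 * (J : ℝ) ^ 2 := by
          refine Finset.sum_le_sum fun j hj => ?_
          have hjJ : (j : ℝ) ≤ J := by exact_mod_cast (Finset.mem_Icc.1 hj).2
          have hj0 : (0 : ℝ) ≤ j := by positivity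
          nlinarith [Real.pi_pos, sq_nonneg Real.pi, mul_le_mul hjJ hjJ hj0 (by positivity)]
      _ = J * (16 * Real.pi ^ 2 * (J : ℝ) ^ 2) := by rw [Finset.sum_const, hcard, nsmul_eq_mul]
  simp only [nsmul_eq_mul] at hsum
  rw [hE₀] at hsum
  have hsP : s / (L : ℝ) ^ 4 * ∑ j ∈ Finset.Icc 1 J,
      ((star (fockTwist (θ j) *ᵥ ψ₀) ⬝ᵥ P *ᵥ (fockTwist (θ j) *ᵥ ψ₀)).re +
        (star (fockTwist (-θ j) *ᵥ ψ₀) ⬝ᵥ P *ᵥ (fockTwist (-θ j) *ᵥ ψ₀)).re) ≤ 32 * s := by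
    calc s / (L : ℝ) ^ 4 * ∑ j ∈ Finset.Icc 1 J,
          ((star (fockTwist (θ j) *ᵥ ψ₀) ⬝ᵥ P *ᵥ (fockTwist (θ j) *ᵥ ψ₀)).re +
            (star (fockTwist (-θ j) *ᵥ ψ₀) ⬝ᵥ P *ᵥ (fockTwist (-θ j) *ᵥ ψ₀)).re)
        ≤ s / (L : ℝ) ^ 4 * (32 * (L : ℝ) ^ 4) :=
          mul_le_mul_of_nonneg_left hweights (div_nonneg hs hL4.le)
      _ = 32 * s := by
          have hne : ((L : ℝ) ^ 4) ≠ 0 := hL4.ne'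
          calc s / (L : ℝ) ^ 4 * (32 * (L : ℝ) ^ 4) = 32 * (s / (L : ℝ) ^ 4 * (L : ℝ) ^ 4) := by ring
            _ = 32 * s := by rw [div_mul_cancel₀ s hne]
  have hR : ((H + ((s / (L : ℝ) ^ 4 : ℝ) : ℂ) • P).minEnergyOn K - H.minEnergyOn K) * (2 * J) ≤
      16 * Real.pi ^ 2 * (J : ℝ) ^ 3 + 32 * s := by nlinarith [hsum, hsq, hsP]
  rw [← le_div_iff₀ (by positivity)] at hR
  refine hR.trans (le_of_eq ?_)
  field_simp
  ring

/-- **TWIST CEILING (softness of the penalised energy), quantitative form.** For all `U, δ` and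
`s ≥ 0`, every side `L ≥ 2⌈s^{1/3}⌉₊ + 1` satisfies `R_L(s) ≤ (32π² + 32)·s^{2/3}`: for `s ≤ 1`,
`R_L(s) ≤ 32 s ≤ 32 s^{2/3}` (`minEnergyOn_penalised_le`; empty sector: `0`); for `s ≥ 1`,
`penaltyGap_le_of_twists` with `J = ⌈s^{1/3}⌉₊ ∈ [s^{1/3}, 2 s^{1/3}]` gives
`8π²J² + 16 s/J ≤ (32π² + 16) s^{2/3}`. Lieb–Schultz–Mattis, Ann. Phys. 16 (1961) 407; Oshikawa,
PRL 84 (2000) 1535; Kennedy–Lieb–Shastry, PRL 61 (1988) 2582. [folklore] -/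
theorem penaltyGap_le_twistCeiling (U δ : ℝ) {s : ℝ} (hs : 0 ≤ s) (L : ℕ) [NeZero L]
    (hL : 2 * ⌈s ^ (1 / 3 : ℝ)⌉₊ + 1 ≤ L) :
    (hubbardTorus 2 L 1 U + ((s / (L : ℝ) ^ 4 : ℝ) : ℂ) •
        ((pairField dWaveFormFactor L)ᴴ * pairField dWaveFormFactor L)).minEnergyOn
        (szSector (2 * ⌊(1 - δ) * (L : ℝ) ^ 2 / 2⌋₊) 0) -
      (hubbardTorus 2 L 1 U).minEnergyOn (szSector (2 * ⌊(1 - δ) * (L : ℝ) ^ 2 / 2⌋₊) 0) ≤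
      (32 * Real.pi ^ 2 + 32) * s ^ (2 / 3 : ℝ) := by
  classical
  set n : ℕ := ⌊(1 - δ) * (L : ℝ) ^ 2 / 2⌋₊ with hn
  set K := szSector (Λ := FermionTorus 2 L) (2 * n) 0 with hK
  have hs23 : 0 ≤ s ^ (2 / 3 : ℝ) := Real.rpow_nonneg hs _
  have hC : 0 ≤ (32 * Real.pi ^ 2 + 32) * s ^ (2 / 3 : ℝ) := by positivity
  by_cases hs1 : s ≤ 1
  · -- small `s`: the penalty costs at most `32 s ≤ 32 s^{2/3}` (or `0` on an empty sector)
    have h2 : s ≤ s ^ (2 / 3 : ℝ) := by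
      rcases hs.eq_or_lt with h0 | h0
      · rw [← h0, Real.zero_rpow (by norm_num)]
      · have := Real.rpow_le_rpow_of_exponent_ge h0 hs1 (show (2 / 3 : ℝ) ≤ 1 by norm_num)
        rwa [Real.rpow_one] at this
    by_cases hKex : ∃ ψ ∈ K, star ψ ⬝ᵥ ψ = 1
    · have h1 := minEnergyOn_penalised_le L U hs K hKex
      nlinarith [Real.pi_pos, sq_nonneg Real.pi]
    · have hempty : ∀ A : Matrix (Finset (Orb (FermionTorus 2 L))) (Finset (Orb (FermionTorus 2 L))) ℂ,
          A.minEnergyOn K = 0 := by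
        intro A
        rw [Matrix.minEnergyOn]
        convert Real.sInf_empty
        rw [Set.eq_empty_iff_forall_notMem]
        rintro E ⟨ψ, hψK, hψ1, -⟩
        exact hKex ⟨ψ, hψK, hψ1⟩
      rw [hempty, hempty, sub_zero]
      exact hC
  -- large `s`: the window average at `J = ⌈s^{1/3}⌉`
  push Not at hs1
  have hs0 : 0 < s := by linarith
  set r : ℝ := s ^ (1 / 3 : ℝ) with hr
  set J : ℕ := ⌈r⌉₊ with hJ
  have hr0 : 0 < r := Real.rpow_pos_of_pos hs0 _
  have hr1 : 1 ≤ r := Real.one_le_rpow hs1.le (by norm_num)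
  have hr3 : r ^ 3 = s := by
    rw [hr, ← Real.rpow_natCast, ← Real.rpow_mul hs]; norm_num
  have hr2 : r ^ 2 = s ^ (2 / 3 : ℝ) := by
    rw [hr, ← Real.rpow_natCast, ← Real.rpow_mul hs]; norm_num
  have hJr : r ≤ J := Nat.le_ceil r
  have hJr' : (J : ℝ) < r + 1 := Nat.ceil_lt_add_one hr0.le
  have hJpos : 0 < J := Nat.ceil_pos.2 hr0
  have hJreal : (0 : ℝ) < J := by exact_mod_cast hJpos
  have h2J : 2 * J < L := by omega
  have hR := penaltyGap_le_of_twists U δ hs L hJpos h2J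
  -- `8π² J² + 16 s/J ≤ (32π² + 16) r²`
  have hJ2 : (J : ℝ) ^ 2 ≤ 4 * r ^ 2 := by nlinarith
  have hsJ : 16 * s / J ≤ 16 * r ^ 2 := by
    rw [div_le_iff₀ hJreal]
    have : 16 * r ^ 2 * r ≤ 16 * r ^ 2 * J := mul_le_mul_of_nonneg_left hJr (by positivity)
    nlinarith
  calc _ ≤ 8 * Real.pi ^ 2 * (J : ℝ) ^ 2 + 16 * s / J := hR
    _ ≤ 8 * Real.pi ^ 2 * (4 * r ^ 2) + 16 * r ^ 2 := by
        have := mul_le_mul_of_nonneg_left hJ2 (show 0 ≤ 8 * Real.pi ^ 2 by positivity)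
        linarith
    _ ≤ (32 * Real.pi ^ 2 + 32) * s ^ (2 / 3 : ℝ) := by rw [← hr2]; nlinarith [Real.pi_pos]

/-- **`TgTwistCeiling` holds** (route `TwistGap`, support item `stmt-HubbardSuperconductivity-1514`):
the universal SOFTNESS CEILING of the penalised sector energy, with the absolute constant
`C = 32π² + 32` and `L₀ = 2⌈s^{1/3}⌉₊ + 1`. In every model, superconducting or not, the chord slope
`R_L(s)/s → 0`: energy-density certificates cannot see `d`-wave LRO, and the penalty corner of route
`DeformationLadder` certifies LRO `a` at scale `s` only if `a·s ≤ C s^{2/3}`. [folklore] -/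
theorem tgTwistCeiling_proof :
    Summit.HubbardSuperconductivity.HubbardSuperconductivity.Theses.TwistGap.TgTwistCeiling := by
  refine ⟨32 * Real.pi ^ 2 + 32, fun U δ s hs => ⟨2 * ⌈s ^ (1 / 3 : ℝ)⌉₊ + 1, fun L _ hL => ?_⟩⟩
  exact penaltyGap_le_twistCeiling U δ hs L hL

end Ceiling


/-! ### Tightness lemmas for the cruxes of route `DeformationLadder` -/

section Tightness

/-- **Tightness of the penalty corner (`LadderThesis`, `stmt-…-1890`).** If, at parameter `s ≥ 0` and
a side `L ≥ 2⌈s^{1/3}⌉₊ + 1`, some normalised `(N_L, S^z=0)`-sector ground state of the penalised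
model `H_L + (s/L⁴)Δ_dᴴΔ_d` has `d`-wave LRO density `≥ a`, then `a·s ≤ (32π² + 32)·s^{2/3}`
(`penaltyGap_ge_of_groundState` + `penaltyGap_le_twistCeiling`). So a `LadderThesis` witness
`(U, δ, s, a)` obeys `a ≤ C s^{-1/3}`. [folklore] -/
theorem lro_mul_le_twistCeiling (U δ : ℝ) {s a : ℝ} (hs : 0 ≤ s) (L : ℕ) [NeZero L]
    (hL : 2 * ⌈s ^ (1 / 3 : ℝ)⌉₊ + 1 ≤ L) {φ : Fock (Orb (FermionTorus 2 L))}
    (hφ1 : star φ ⬝ᵥ φ = 1)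
    (hφ : IsGroundStateInSector (hubbardTorus 2 L 1 U + ((s / (L : ℝ) ^ 4 : ℝ) : ℂ) •
      ((pairField dWaveFormFactor L)ᴴ * pairField dWaveFormFactor L))
      (2 * ⌊(1 - δ) * (L : ℝ) ^ 2 / 2⌋₊) 0 φ)
    (ha : a ≤ (expect ((pairField dWaveFormFactor L)ᴴ * pairField dWaveFormFactor L) φ).re /
      (L : ℝ) ^ 4) :
    a * s ≤ (32 * Real.pi ^ 2 + 32) * s ^ (2 / 3 : ℝ) :=
  (penaltyGap_ge_of_groundState L U hs _ hφ1 hφ ha).trans (penaltyGap_le_twistCeiling U δ hs L hL)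

/-- The same bound in closed form: `a³·s ≤ (32π² + 32)³` (cube `a·s ≤ C s^{2/3}` and cancel `s²`;
for `a ≥ 0`). [folklore] -/
theorem lro_cube_mul_le_twistCeiling (U δ : ℝ) {s a : ℝ} (hs : 0 ≤ s) (ha0 : 0 ≤ a) (L : ℕ) [NeZero L]
    (hL : 2 * ⌈s ^ (1 / 3 : ℝ)⌉₊ + 1 ≤ L) {φ : Fock (Orb (FermionTorus 2 L))}
    (hφ1 : star φ ⬝ᵥ φ = 1)
    (hφ : IsGroundStateInSector (hubbardTorus 2 L 1 U + ((s / (L : ℝ) ^ 4 : ℝ) : ℂ) •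
      ((pairField dWaveFormFactor L)ᴴ * pairField dWaveFormFactor L))
      (2 * ⌊(1 - δ) * (L : ℝ) ^ 2 / 2⌋₊) 0 φ)
    (ha : a ≤ (expect ((pairField dWaveFormFactor L)ᴴ * pairField dWaveFormFactor L) φ).re /
      (L : ℝ) ^ 4) :
    a ^ 3 * s ≤ (32 * Real.pi ^ 2 + 32) ^ 3 := by
  have h := lro_mul_le_twistCeiling U δ hs L hL hφ1 hφ ha
  set C : ℝ := 32 * Real.pi ^ 2 + 32 with hC
  have hC0 : 0 ≤ C := by positivity
  rcases hs.eq_or_lt with h0 | h0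
  · rw [← h0, mul_zero]; positivity
  have h3 := pow_le_pow_left₀ (mul_nonneg ha0 hs) h 3
  have hs2 : (s ^ (2 / 3 : ℝ)) ^ 3 = s ^ 2 := by
    rw [← Real.rpow_natCast, ← Real.rpow_mul hs]; norm_num
  rw [mul_pow, mul_pow, hs2] at h3
  have hs3 : 0 < s ^ 2 := by positivity
  nlinarith [h3, hs3, mul_le_mul_of_nonneg_right h3 hs]

/-- **Tightness of the corner crux (`LowEnergyRigidity`, `stmt-…-1892`).** If at a side
`L ≥ 2⌈(κ/64)^{1/3}⌉₊ + 1` with a nonempty `(N_L, S^z = 0)` sector (`⌊(1−δ)L²/2⌋ ≤ L²`) every unit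
sector vector within energy `κ > 0` of the sector ground energy has LRO density `≥ a`, then
`a·(κ/64) ≤ (32π² + 32)·(κ/64)^{2/3}` — i.e. `a³ κ ≤ 64 C³`: the rigidity scale `κ` of a
`LowEnergyRigidity` witness is capped by the cube of the inverse order, the quantitative form of
"the one-flux twist forces `κ < c·ρ_s`" (here for the `⌈(κ/64)^{1/3}⌉`-fold twists). Chain:
`stiffnessImpliesPenalised_proof` (penalised ground states at `s = κ/64` keep LRO `a`),
`penalisedGroundStateExists_proof`, `lro_mul_le_twistCeiling`. [folklore] -/
theorem rigidity_scale_le_twistCeiling (U δ : ℝ) {κ a : ℝ} (hκ : 0 < κ) (L : ℕ) [NeZero L]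
    (hL : 2 * ⌈(κ / 64) ^ (1 / 3 : ℝ)⌉₊ + 1 ≤ L) (hn : ⌊(1 - δ) * (L : ℝ) ^ 2 / 2⌋₊ ≤ L ^ 2)
    (hrig : ∀ φ : Fock (Orb (FermionTorus 2 L)),
      φ ∈ szSector (2 * ⌊(1 - δ) * (L : ℝ) ^ 2 / 2⌋₊) 0 → star φ ⬝ᵥ φ = 1 →
        (star φ ⬝ᵥ Matrix.mulVec (hubbardTorus 2 L 1 U) φ).re ≤
          (hubbardTorus 2 L 1 U).minEnergyOn (szSector (2 * ⌊(1 - δ) * (L : ℝ) ^ 2 / 2⌋₊) 0) + κ →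
        a ≤ (expect ((pairField dWaveFormFactor L)ᴴ * pairField dWaveFormFactor L) φ).re /
          (L : ℝ) ^ 4) :
    a * (κ / 64) ≤ (32 * Real.pi ^ 2 + 32) * (κ / 64) ^ (2 / 3 : ℝ) := by
  obtain ⟨φ, hφ1, hφ⟩ := penalisedGroundStateExists_proof L U ((κ / 64) / (L : ℝ) ^ 4)
    (⌊(1 - δ) * (L : ℝ) ^ 2 / 2⌋₊) hn
  have ha := stiffnessImpliesPenalised_proof L U κ a (2 * ⌊(1 - δ) * (L : ℝ) ^ 2 / 2⌋₊) hκ hrig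
    (κ / 64) ⟨by positivity, le_rfl⟩ φ hφ1 hφ
  exact lro_mul_le_twistCeiling U δ (by positivity) L hL hφ1 hφ ha

end Tightness

end Summit.HubbardSuperconductivity.HubbardSuperconductivity.Theorems.DeformationLadder
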